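import Literature.NumberTheory.Automorphic.SymplecticGroupIwasawaExponents
import Literature.NumberTheory.Automorphic.HyperspecialUnitaryIwasawaCartan
import HarnessLib

/-!
# Iwasawa versus Cartan for `Sp_{2n}`: the exponents of the cosets in `K₀ d(a) K₀` are dominated by `a`
# (Bruhat–Tits 1972, Prop. (4.4.4) (i), for the symplectic group)

Topic `NumberTheory/Automorphic`; namespace `Literature.NumberTheory.Automorphic.SymplecticCartan` (lane `lit-hodgefound`,
Track 2 foundations; seat `lit-hodgefound-p11`, generation 37, row g37-#11).  THEOREMS ONLY: no definition, no named fact,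
no instance, no notation.  Sequel of `SymplecticGroupIwasawaExponents` (`symplecticIwasawaExp`: `g ∈ B(K) · Sp(J, 𝒪)`,
`aᵢ(g) = ord p_{inl i, inl i}`), `SymplecticGroupCartanUnique` (`exists_cartan_decomposition_antitone`: `k₁ g k₂ = d(a) =
diag(ϖ^{a}; ϖ^{-a})`, `a₁ ≥ ⋯ ≥ aₙ ≥ 0`) and the minor calculus of `HyperspecialUnitaryIwasawaCartan` (there for `Fin N`;
§1 here redoes it for an arbitrary index type, as `Sp` lives on `Fin n ⊕ Fin n`).  The `Sp_{2n}` counterpart of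
`HyperspecialUnitaryIwasawaCartan` (unitary groups) and `CartanIwasawaDominanceGL` (`GL_n`).

## The print

[BruhatTits1972] Prop. (4.4.4): «(i) Si `K.t.K ∩ B̂⁰.t'.K ≠ ∅`, on a `t' ≤ t`.» — for `G = Sp_{2n}(K)`, `K = Sp_{2n}(𝒪)`
hyperspecial, `t = d(a)` with `a` dominant (`a₁ ≥ ⋯ ≥ aₙ ≥ 0`) and `t'` the torus part of an Iwasawa decomposition of an
element of `KtK`: the cocharacter `a(g)` is dominated by `a`, i.e. `Σ_{i<r} a(g)ᵢ ≤ Σ_{i<r} aᵢ` for all `r`.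
[Macdonald1995] Ch. II §1 and Ch. V (2.6) (the same via elementary divisors: the `r × r` minors of `k₁ d(a) k₂` have
valuation `≤` that of the smallest `r × r` minor of `d(a)`); [CartierCorvallis1979] §IV, proof of Thm. 4.1 (c).
PROOF here: write `g = p k` (`p ∈ B(K)`, `k ∈ Sp(J, 𝒪)`), so `p = k₁⁻¹ d(a) k₂⁻¹ k⁻¹`; the `r × r` minor of `p` on the
rows/columns `inr 0, …, inr (r-1)` is upper triangular with diagonal `p_{inr i, inr i} = p_{inl i, inl i}⁻¹`, of valuation
`exp(Σ_{i<r} a(g)ᵢ)`; every `r × r` minor of `k₁⁻¹ d(a) k₂⁻¹ k⁻¹` has valuation `≤ exp(Σ_{i<r} aᵢ)` (Cauchy–Binet, the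
`r` largest entries `ϖ^{-a₀}, …, ϖ^{-a_{r-1}}` of `d(a)`).

## What is formalised (`K` a field with `Valued K ℤᵐ⁰`, uniformiser `ϖ`)

* §1 minors over an arbitrary index type `m`: `v_minor_mul_le`, `v_minor_mul_le'` (multiplication by integral matrices
  preserves a bound on all `r × r` minors), `v_minor_diagonal_le`, `v_minor_le_of_eq_mul_diagonal_mul`.
* §2 `sum_le_headSum_of_card_le` (for `a` antitone on `Fin n`, `ℕ`-valued, and `|S| ≤ r`: `Σ_{i∈S} aᵢ ≤ Σ_{i<r} aᵢ`),
  `prod_v_cartanDiagonal_le` (any `r` distinct entries of `d(a)` have product of valuation `≤ exp(Σ_{i<r} aᵢ)`).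
* §3 `det_submatrix_inr_of_mem_symplecticBorel` (the `inr`-corner minor of `p ∈ B(K)` is `Π_{i<r} p_{inr i, inr i}`),
  `v_apply_inr_eq_exp` (`v(p_{inr i, inr i}) = exp(a(g)ᵢ)`).
* §4 **`sum_symplecticIwasawaExp_head_le`** — BRUHAT–TITS (4.4.4) (i) FOR `Sp_{2n}`: if `gK₀ ⊆ K₀ d(a) K₀` with `a`
  antitone then `Σ_{i<r} a(g)ᵢ ≤ Σ_{i<r} aᵢ` for every `r`; `symplecticIwasawaExp_out_cartanDiagonal` (the top coset),
  `symplecticIwasawaExp_eq_of_mem_orbit_of_forall_le` (equality case), `heckeCosetMk_cartanDiagonal_eq` /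
  `exists_antitone_mem_orbit` (every coset lies in some `K₀ d(a) K₀`, `a` antitone — the Cartan decomposition recast).

## References
* [BruhatTits1972] F. Bruhat, J. Tits, *Groupes réductifs sur un corps local. I*, Publ. Math. IHÉS 41 (1972), Prop. (4.4.4).
* [Macdonald1995] I. G. Macdonald, *Symmetric Functions and Hall Polynomials*, 2nd ed. (1995), Ch. II §1; Ch. V (2.6).
* [CartierCorvallis1979] P. Cartier, *Representations of 𝔭-adic groups: a survey*, PSPM 33.1 (1979), §IV Thm. 4.1, proof (c).
-/

noncomputable section

open scoped Valued WithZero MatrixGroups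
open Matrix Finset

namespace Literature.NumberTheory.Automorphic.SymplecticCartan

open Literature.NumberTheory.Automorphic.CartanUnique Literature.NumberTheory.Automorphic.HermitianLattice

variable {K : Type*} [Field K] [Valued K ℤᵐ⁰] {m : Type*} [Fintype m] [DecidableEq m]

/-! ## §1 Minors under multiplication by integral matrices (arbitrary index type) -/

/-- **Right multiplication by an integral matrix preserves a bound on the `r × r` minors** (columns of `M P` are
`𝒪`-combinations of columns of `M`; Cauchy–Binet). [cite: Macdonald1995, Ch. II §1] -/
theorem v_minor_mul_le {r : ℕ} {t : ℤᵐ⁰} {M P : Matrix m m K}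
    (hM : ∀ (ρ c : Fin r → m), Function.Injective c → Valued.v (M.submatrix ρ c).det ≤ t)
    (hP : ∀ i j, Valued.v (P i j) ≤ 1) (ρ c : Fin r → m) :
    Valued.v ((M * P).submatrix ρ c).det ≤ t := by
  classical
  rw [Matrix.submatrix_mul M P ρ id c Function.bijective_id, Literature.Analysis.TotalPositivity.det_mul_eq_sum_pi]
  refine Valuation.map_sum_le _ fun p _ => ?_
  rw [map_mul]
  have h1 : Valued.v (∏ i, (P.submatrix id c) (p i) i) ≤ 1 := v_prod_le_one _ fun i _ => hP (p i) (c i)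
  have h2 : Valued.v ((M.submatrix ρ id).submatrix id p).det ≤ t := by
    by_cases hp : Function.Injective p
    · rw [Matrix.submatrix_submatrix, Function.comp_id, Function.id_comp]
      exact hM ρ p hp
    · rw [Literature.Analysis.TotalPositivity.det_submatrix_eq_zero_of_not_injective _ hp, map_zero]
      exact zero_le
  calc Valued.v (∏ i, (P.submatrix id c) (p i) i) * Valued.v ((M.submatrix ρ id).submatrix id p).det ≤ 1 * t :=
      mul_le_mul' h1 h2
    _ = t := one_mul t

/-- **Left multiplication by an integral matrix preserves a bound on the `r × r` minors.** [cite: Macdonald1995, Ch. II §1] -/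
theorem v_minor_mul_le' {r : ℕ} {t : ℤᵐ⁰} {M P : Matrix m m K} (hP : ∀ i j, Valued.v (P i j) ≤ 1)
    (hM : ∀ (ρ c : Fin r → m), Function.Injective c → Valued.v (M.submatrix ρ c).det ≤ t)
    (ρ c : Fin r → m) (hc : Function.Injective c) :
    Valued.v ((P * M).submatrix ρ c).det ≤ t := by
  classical
  rw [← Matrix.det_transpose, Matrix.transpose_submatrix, Matrix.transpose_mul,
    Matrix.submatrix_mul _ _ c id ρ Function.bijective_id, Literature.Analysis.TotalPositivity.det_mul_eq_sum_pi]
  refine Valuation.map_sum_le _ fun p _ => ?_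
  rw [map_mul]
  have h1 : Valued.v (∏ i, (P.transpose.submatrix id ρ) (p i) i) ≤ 1 := v_prod_le_one _ fun i _ => hP (ρ i) (p i)
  have h2 : Valued.v ((M.transpose.submatrix c id).submatrix id p).det ≤ t := by
    rw [Matrix.submatrix_submatrix, Function.comp_id, Function.id_comp, ← Matrix.transpose_submatrix,
      Matrix.det_transpose]
    exact hM p c hc
  calc Valued.v (∏ i, (P.transpose.submatrix id ρ) (p i) i) * Valued.v ((M.transpose.submatrix c id).submatrix id p).det
      ≤ 1 * t := mul_le_mul' h1 h2
    _ = t := one_mul t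

omit [Fintype m] in
/-- **The minors of a diagonal matrix**: if every product of `r` distinct diagonal entries has valuation `≤ s`, so does
every `r × r` minor with injective column selection. [cite: Macdonald1995, Ch. II §1] -/
theorem v_minor_diagonal_le {r : ℕ} {d : m → K} {s : ℤᵐ⁰}
    (hd : ∀ c : Fin r → m, Function.Injective c → ∏ j, Valued.v (d (c j)) ≤ s) (ρ c : Fin r → m)
    (hc : Function.Injective c) : Valued.v ((Matrix.diagonal d).submatrix ρ c).det ≤ s := by
  classical
  rw [Matrix.det_apply']
  refine Valuation.map_sum_le _ fun τ _ => ?_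
  have hterm : Valued.v (∏ i, (Matrix.diagonal d).submatrix ρ c (τ i) i) ≤ s := by
    rw [map_prod]
    calc ∏ i, Valued.v ((Matrix.diagonal d).submatrix ρ c (τ i) i) ≤ ∏ i, Valued.v (d (c i)) := by
          refine Finset.prod_le_prod' fun i _ => ?_
          rw [Matrix.submatrix_apply, Matrix.diagonal_apply]
          split_ifs with h
          · rw [h]
          · rw [map_zero]; exact zero_le
      _ ≤ s := hd c hc
  have hsign : Valued.v (((Equiv.Perm.sign τ : ℤˣ) : ℤ) : K) ≤ 1 := by
    rcases Int.units_eq_one_or (Equiv.Perm.sign τ) with h | h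
    · rw [h, Units.val_one, Int.cast_one, map_one]
    · rw [h, Units.val_neg, Units.val_one, Int.cast_neg, Int.cast_one, Valuation.map_neg, map_one]
  rw [map_mul]
  calc Valued.v (((Equiv.Perm.sign τ : ℤˣ) : ℤ) : K) * Valued.v (∏ i, (Matrix.diagonal d).submatrix ρ c (τ i) i)
      ≤ 1 * s := mul_le_mul' hsign hterm
    _ = _ := one_mul _

/-- **Minors of `k₁ · diag(d) · k₂ · P`** for integral `k₁, k₂, P`: bounded by the bound on the products of `r` distinct
entries of `d` (the easy half of the theory of elementary divisors). [cite: Macdonald1995, Ch. II §1] -/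
theorem v_minor_le_of_eq_mul_diagonal_mul {r : ℕ} {d : m → K} {s : ℤᵐ⁰}
    (hd : ∀ c : Fin r → m, Function.Injective c → ∏ j, Valued.v (d (c j)) ≤ s) {k₁ k₂ P b : Matrix m m K}
    (hk₁ : ∀ i j, Valued.v (k₁ i j) ≤ 1) (hk₂ : ∀ i j, Valued.v (k₂ i j) ≤ 1) (hP : ∀ i j, Valued.v (P i j) ≤ 1)
    (h : b = k₁ * Matrix.diagonal d * k₂ * P) (ρ c : Fin r → m) : Valued.v (b.submatrix ρ c).det ≤ s := by
  rw [h]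
  refine v_minor_mul_le (fun ρ' c' _ => ?_) hP ρ c
  refine v_minor_mul_le (fun ρ'' c'' hc'' => ?_) hk₂ ρ' c'
  exact v_minor_mul_le' hk₁ (fun ρ₃ c₃ hc₃ => v_minor_diagonal_le hd ρ₃ c₃ hc₃) ρ'' c'' hc''

/-! ## §2 The `r` largest entries of `d(a)` -/

variable {n : ℕ}

omit [Valued K ℤᵐ⁰] in
/-- A strictly monotone map `Fin k → Fin n` dominates the index: `j ≤ e j`. [cite: Macdonald1995, Ch. I §1] -/
theorem le_apply_of_strictMono_fin {k : ℕ} {e : Fin k → Fin n} (he : StrictMono e) :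
    ∀ (j : ℕ) (hj : j < k), j ≤ (e ⟨j, hj⟩ : ℕ)
  | 0, _ => Nat.zero_le _
  | j + 1, hj => by
    have h1 : (⟨j, by omega⟩ : Fin k) < ⟨j + 1, hj⟩ := Fin.mk_lt_mk.2 (Nat.lt_succ_self j)
    have h2 := Fin.lt_def.1 (he h1)
    have h3 := le_apply_of_strictMono_fin he j (by omega)
    omega

omit [Valued K ℤᵐ⁰] in
/-- **Any `|S| ≤ r` values of an antitone `a ≥ 0` sum to at most the `r` largest**: `Σ_{i ∈ S} aᵢ ≤ Σ_{i<r} aᵢ`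
(enumerate `S` increasingly as `s₀ < s₁ < ⋯`; then `s_j ≥ j`, so `a_{s_j} ≤ a_j`). [cite: Macdonald1995, Ch. I §1] -/
theorem sum_le_headSum_of_card_le {a : Fin n → ℕ} (ha : Antitone a) {r : ℕ} (S : Finset (Fin n)) (hS : S.card ≤ r) :
    ∑ i ∈ S, a i ≤ ∑ i : Fin n, if (i : ℕ) < r then a i else 0 := by
  classical
  set k := S.card with hk
  -- enumerate `S` increasingly
  have hsum : ∑ i ∈ S, a i = ∑ j : Fin k, a (S.orderEmbOfFin rfl j) := by
    rw [← Finset.sum_coe_sort S, ← (S.orderIsoOfFin rfl).sum_comp]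
    rfl
  rw [hsum]
  -- compare termwise with the first `k` indices, then enlarge to the first `r`
  calc ∑ j : Fin k, a (S.orderEmbOfFin rfl j) ≤ ∑ j : Fin k, a (Fin.castLE (hk ▸ S.card_le_univ.trans_eq (by simp)) j) := by
        refine Finset.sum_le_sum fun j _ => ha ?_
        rw [Fin.le_def, Fin.val_castLE]
        exact le_apply_of_strictMono_fin (S.orderEmbOfFin rfl).strictMono j j.isLt
    _ = ∑ i : Fin n, if (i : ℕ) < k then a i else 0 := by
        rw [← Finset.sum_filter]
        refine Finset.sum_bij (fun j _ => Fin.castLE (hk ▸ S.card_le_univ.trans_eq (by simp)) j) (fun j _ => ?_)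
          (fun _ _ _ _ h => ?_) (fun i hi => ?_) (fun _ _ => rfl)
        · simp only [Finset.mem_filter, Finset.mem_univ, true_and, Fin.val_castLE]
          exact j.isLt
        · exact Fin.castLE_injective _ h
        · simp only [Finset.mem_filter, Finset.mem_univ, true_and] at hi
          exact ⟨⟨i, hi⟩, Finset.mem_univ _, Fin.ext rfl⟩
    _ ≤ ∑ i : Fin n, if (i : ℕ) < r then a i else 0 := by
        refine Finset.sum_le_sum fun i _ => ?_
        by_cases h : (i : ℕ) < k
        · rw [if_pos h, if_pos (lt_of_lt_of_le h hS)]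
        · rw [if_neg h]
          exact Nat.zero_le _

variable {ϖ : K}

/-- **The `r` largest entries of the Cartan diagonal**: for `a` antitone, any `r` distinct diagonal entries of
`d(a) = diag(ϖ^{a}; ϖ^{-a})` have product of valuation `≤ exp(Σ_{i<r} aᵢ)` (the `inl`-entries have valuation `≤ 1`, the
`inr`-entries `exp(aᵢ)`). [cite: Macdonald1995, Ch. II §1] [cite: BruhatTits1972, Prop. (4.4.4)] -/
theorem prod_v_cartanDiagonal_le (hϖ : Valued.v ϖ = WithZero.exp (-1 : ℤ)) {a : Fin n → ℕ} (ha : Antitone a) {r : ℕ}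
    (c : Fin r → Fin n ⊕ Fin n) (hc : Function.Injective c) :
    ∏ j, Valued.v (Sum.elim (fun i => ϖ ^ a i) (fun i => (ϖ ^ a i)⁻¹) (c j)) ≤
      WithZero.exp ((∑ i : Fin n, if (i : ℕ) < r then a i else 0 : ℕ) : ℤ) := by
  classical
  -- bound each factor by `exp (g (c j))`, `g = 0` on `inl`, `g = a` on `inr`
  set g : Fin n ⊕ Fin n → ℕ := Sum.elim (fun _ => 0) (fun i => a i) with hg
  have hfac : ∀ x : Fin n ⊕ Fin n, Valued.v (Sum.elim (fun i => ϖ ^ a i) (fun i => (ϖ ^ a i)⁻¹) x) ≤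
      WithZero.exp ((g x : ℕ) : ℤ) := by
    rintro (i | i)
    · rw [Sum.elim_inl, hg, Sum.elim_inl, Nat.cast_zero, WithZero.exp_zero, map_pow, hϖ, ← WithZero.exp_nsmul,
        ← WithZero.exp_zero, WithZero.exp_le_exp]
      simp
    · rw [Sum.elim_inr, hg, Sum.elim_inr, map_inv₀, map_pow, hϖ, ← WithZero.exp_nsmul, ← WithZero.exp_neg,
        WithZero.exp_le_exp]
      simp
  calc ∏ j, Valued.v (Sum.elim (fun i => ϖ ^ a i) (fun i => (ϖ ^ a i)⁻¹) (c j))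
      ≤ ∏ j, WithZero.exp ((g (c j) : ℕ) : ℤ) := Finset.prod_le_prod' fun j _ => hfac (c j)
    _ = WithZero.exp ((∑ j, g (c j) : ℕ) : ℤ) := by
        rw [Nat.cast_sum]
        have h := prod_exp_neg_eq Finset.univ (fun j => -((g (c j) : ℕ) : ℤ))
        simpa only [neg_neg, Finset.sum_neg_distrib] using h
    _ ≤ WithZero.exp ((∑ i : Fin n, if (i : ℕ) < r then a i else 0 : ℕ) : ℤ) := by
        rw [WithZero.exp_le_exp, Nat.cast_le]
        -- `Σ_j g (c j) = Σ_{i ∈ S} a i` with `S = {i : inr i ∈ range c}`, `|S| ≤ r`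
        have hsum : ∑ j, g (c j) = ∑ x ∈ Finset.univ.image c, g x := by
          rw [Finset.sum_image fun x _ y _ h => hc h]
        rw [hsum]
        set S : Finset (Fin n) := (Finset.univ.image c).preimage Sum.inr Sum.inr_injective.injOn with hS
        have hsplit : ∑ x ∈ Finset.univ.image c, g x = ∑ i ∈ S, a i := by
          rw [← Finset.sum_preimage Sum.inr (Finset.univ.image c) Sum.inr_injective.injOn g]
          · rfl
          · rintro (i | i) hx hni
            · rfl
            · exact absurd (Set.mem_range_self i) hni
        rw [hsplit]
        refine sum_le_headSum_of_card_le ha S ?_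
        calc S.card ≤ (Finset.univ.image c).card := by
              rw [hS]
              refine Finset.card_le_card_of_injOn Sum.inr (fun i hi => Finset.mem_preimage.1 hi) ?_
              exact Sum.inr_injective.injOn
          _ ≤ (Finset.univ : Finset (Fin r)).card := Finset.card_image_le
          _ = r := by simp

/-! ## §3 The `inr`-corner minor of a Borel element -/

omit [Valued K ℤᵐ⁰] in
/-- **The `inr`-corner minor of `p ∈ B(K)`**: on the rows and columns `inr 0, …, inr (r-1)` the matrix `p` is upper
triangular, so the minor is `Π_{i<r} p_{inr i, inr i}`. [cite: BruhatTits1972, Prop. (4.4.4)] -/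
theorem det_submatrix_inr_of_mem_symplecticBorel {p : symplecticGroup (Fin n) K} (hp : p ∈ symplecticBorel n K) {r : ℕ}
    (hr : r ≤ n) :
    ((p : Matrix (Fin n ⊕ Fin n) (Fin n ⊕ Fin n) K).submatrix (fun j : Fin r => Sum.inr (Fin.castLE hr j))
        (fun j : Fin r => Sum.inr (Fin.castLE hr j))).det =
      ∏ j : Fin r, (p : Matrix (Fin n ⊕ Fin n) (Fin n ⊕ Fin n) K) (Sum.inr (Fin.castLE hr j)) (Sum.inr (Fin.castLE hr j)) := by
  obtain ⟨-, h₂, -⟩ := (blockTriangular_symplecticBorelOrder_iff _).1 (mem_symplecticBorel_iff.1 hp)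
  have htri : ((p : Matrix (Fin n ⊕ Fin n) (Fin n ⊕ Fin n) K).submatrix (fun j : Fin r => Sum.inr (Fin.castLE hr j))
      (fun j : Fin r => Sum.inr (Fin.castLE hr j))).BlockTriangular id := by
    intro i j hij
    exact h₂ _ _ (Fin.lt_def.2 (by rw [Fin.val_castLE, Fin.val_castLE]; exact Fin.lt_def.1 hij))
  rw [Matrix.det_of_upperTriangular htri]
  rfl

/-- **The `inr`-diagonal of the Borel part has valuation `exp(a(g)ᵢ)`** (`p_{inr i, inr i} p_{inl i, inl i} = 1`).
[cite: BruhatTits1972, §4.4 (4.4.3)] -/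
theorem v_apply_inr_eq_exp (hϖ : Valued.v ϖ = WithZero.exp (-1 : ℤ)) {g p k : symplecticGroup (Fin n) K}
    (hp : p ∈ symplecticBorel n K) (hk : k ∈ symplecticInt (Fin n) K) (h : g = p * k) (i : Fin n) :
    Valued.v ((p : Matrix (Fin n ⊕ Fin n) (Fin n ⊕ Fin n) K) (Sum.inr i) (Sum.inr i)) =
      WithZero.exp (symplecticIwasawaExp hϖ g i) := by
  have h1 := congrArg Valued.v (apply_inr_mul_apply_inl_eq_one hp i)
  rw [map_mul, map_one, v_apply_inl_eq_exp_neg hϖ hp hk h i] at h1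
  calc Valued.v ((p : Matrix (Fin n ⊕ Fin n) (Fin n ⊕ Fin n) K) (Sum.inr i) (Sum.inr i))
      = Valued.v ((p : Matrix (Fin n ⊕ Fin n) (Fin n ⊕ Fin n) K) (Sum.inr i) (Sum.inr i)) *
          (WithZero.exp (-symplecticIwasawaExp hϖ g i) * WithZero.exp (symplecticIwasawaExp hϖ g i)) := by
        rw [← WithZero.exp_add, neg_add_cancel, WithZero.exp_zero, mul_one]
    _ = WithZero.exp (symplecticIwasawaExp hϖ g i) := by rw [← mul_assoc, h1, one_mul]

/-! ## §4 Bruhat–Tits (4.4.4) (i) for `Sp_{2n}` -/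

/-- **BRUHAT–TITS (4.4.4) (i) FOR `Sp_{2n}`** («Si `K.t.K ∩ B̂⁰.t'.K ≠ ∅`, on a `t' ≤ t`»): if the coset `gK₀` lies in
`K₀ d(a) K₀`, `d(a) = diag(ϖ^{a}; ϖ^{-a})` with `a` antitone, then the Iwasawa exponents are DOMINATED by `a`:
`Σ_{i<r} a(g)ᵢ ≤ Σ_{i<r} aᵢ` for every `r`. [cite: BruhatTits1972, Prop. (4.4.4) (i)] [cite: Macdonald1995, Ch. V (2.6)] -/
theorem sum_symplecticIwasawaExp_head_le (hϖ : Valued.v ϖ = WithZero.exp (-1 : ℤ)) {a : Fin n → ℕ} (ha : Antitone a)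
    {g : symplecticGroup (Fin n) K}
    (hg : (g : symplecticGroup (Fin n) K ⧸ symplecticInt (Fin n) K) ∈ MulAction.orbit (symplecticInt (Fin n) K)
      ((⟨Matrix.diagonal (Sum.elim (fun i => ϖ ^ a i) (fun i => (ϖ ^ a i)⁻¹)),
          diagonal_pow_mem_symplecticGroup (CartanUnique.uniformizer_ne_zero hϖ) a⟩ : symplecticGroup (Fin n) K) :
        symplecticGroup (Fin n) K ⧸ symplecticInt (Fin n) K))
    (r : ℕ) :
    (∑ i : Fin n, if (i : ℕ) < r then symplecticIwasawaExp hϖ g i else 0) ≤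
      ((∑ i : Fin n, if (i : ℕ) < r then a i else 0 : ℕ) : ℤ) := by
  -- reduce to `r ≤ n`
  wlog hr : r ≤ n generalizing r
  · have h := this n le_rfl
    have h1 : (∑ i : Fin n, if (i : ℕ) < r then symplecticIwasawaExp hϖ g i else 0) =
        ∑ i : Fin n, if (i : ℕ) < n then symplecticIwasawaExp hϖ g i else 0 :=
      Finset.sum_congr rfl fun i _ => by rw [if_pos (by omega), if_pos i.isLt]
    have h2 : (∑ i : Fin n, if (i : ℕ) < r then a i else 0) = ∑ i : Fin n, if (i : ℕ) < n then a i else 0 :=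
      Finset.sum_congr rfl fun i _ => by rw [if_pos (by omega), if_pos i.isLt]
    rw [h1, h2]
    exact h
  obtain ⟨A, hA, B, hB, hgAB⟩ := (heckeAlgebra.coe_mem_orbit_coe_iff (symplecticInt (Fin n) K) _ _).1 hg
  obtain ⟨p, k, hp, hk, hpk⟩ := exists_mem_symplecticBorel_mul_symplecticInt hϖ g
  -- `p = A · d(a) · B · k⁻¹` as matrices
  have hmat : (p : Matrix (Fin n ⊕ Fin n) (Fin n ⊕ Fin n) K) =
      (A : Matrix (Fin n ⊕ Fin n) (Fin n ⊕ Fin n) K) * Matrix.diagonal (Sum.elim (fun i => ϖ ^ a i) (fun i => (ϖ ^ a i)⁻¹)) *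
        (B : Matrix (Fin n ⊕ Fin n) (Fin n ⊕ Fin n) K) * ((k⁻¹ : symplecticGroup (Fin n) K) : Matrix (Fin n ⊕ Fin n) (Fin n ⊕ Fin n) K) := by
    have hpk' : p = g * k⁻¹ := by rw [hpk, mul_inv_cancel_right]
    rw [hpk', hgAB, Submonoid.coe_mul, Submonoid.coe_mul, Submonoid.coe_mul]
  -- the `inr`-corner minor of `p`
  have hmin := v_minor_le_of_eq_mul_diagonal_mul (prod_v_cartanDiagonal_le hϖ ha) (mem_symplecticInt_iff.1 hA)
    (mem_symplecticInt_iff.1 hB) (mem_symplecticInt_iff.1 ((symplecticInt (Fin n) K).inv_mem hk)) hmat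
    (fun j : Fin r => Sum.inr (Fin.castLE hr j)) (fun j : Fin r => Sum.inr (Fin.castLE hr j))
  rw [det_submatrix_inr_of_mem_symplecticBorel hp hr, map_prod] at hmin
  simp_rw [v_apply_inr_eq_exp hϖ hp hk hpk] at hmin
  have hprod : ∏ j : Fin r, WithZero.exp (symplecticIwasawaExp hϖ g (Fin.castLE hr j)) =
      WithZero.exp (∑ j : Fin r, symplecticIwasawaExp hϖ g (Fin.castLE hr j)) := by
    have h := prod_exp_neg_eq Finset.univ (fun j : Fin r => -symplecticIwasawaExp hϖ g (Fin.castLE hr j))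
    simpa only [neg_neg, Finset.sum_neg_distrib] using h
  -- `Σ_j a(g)_{castLE j} = Σ_{i<r} a(g)_i`
  have hre : ∀ f : Fin n → ℤ, ∑ j : Fin r, f (Fin.castLE hr j) = ∑ i : Fin n, if (i : ℕ) < r then f i else 0 := fun f => by
    rw [← Finset.sum_filter]
    refine Finset.sum_bij (fun j _ => Fin.castLE hr j) (fun j _ => ?_) (fun _ _ _ _ h => Fin.castLE_injective _ h)
      (fun i hi => ?_) (fun _ _ => rfl)
    · simp only [Finset.mem_filter, Finset.mem_univ, true_and, Fin.val_castLE]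
      exact j.isLt
    · simp only [Finset.mem_filter, Finset.mem_univ, true_and] at hi
      exact ⟨⟨i, hi⟩, Finset.mem_univ _, Fin.ext rfl⟩
  rw [hprod, WithZero.exp_le_exp, hre] at hmin
  exact hmin

/-- The coset of `d(a)` itself has exponents `a` (the top term). [cite: BruhatTits1972, Prop. (4.4.4) (ii)] -/
theorem symplecticIwasawaExp_out_cartanDiagonal (hϖ : Valued.v ϖ = WithZero.exp (-1 : ℤ)) (a : Fin n → ℕ) :
    symplecticIwasawaExp hϖ ((⟨Matrix.diagonal (Sum.elim (fun i => ϖ ^ a i) (fun i => (ϖ ^ a i)⁻¹)),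
          diagonal_pow_mem_symplecticGroup (CartanUnique.uniformizer_ne_zero hϖ) a⟩ : symplecticGroup (Fin n) K) :
        symplecticGroup (Fin n) K ⧸ symplecticInt (Fin n) K).out = fun i => (a i : ℤ) := by
  rw [← symplecticIwasawaExp_diagonal hϖ a]
  obtain ⟨k, hk, h⟩ : ∃ k ∈ symplecticInt (Fin n) K, ((⟨Matrix.diagonal (Sum.elim (fun i => ϖ ^ a i) (fun i => (ϖ ^ a i)⁻¹)),
          diagonal_pow_mem_symplecticGroup (CartanUnique.uniformizer_ne_zero hϖ) a⟩ : symplecticGroup (Fin n) K) :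
        symplecticGroup (Fin n) K ⧸ symplecticInt (Fin n) K).out = ⟨_, diagonal_pow_mem_symplecticGroup
          (CartanUnique.uniformizer_ne_zero hϖ) a⟩ * k := by
    refine ⟨(⟨_, diagonal_pow_mem_symplecticGroup (CartanUnique.uniformizer_ne_zero hϖ) a⟩ : symplecticGroup (Fin n) K)⁻¹ *
      ((⟨_, diagonal_pow_mem_symplecticGroup (CartanUnique.uniformizer_ne_zero hϖ) a⟩ : symplecticGroup (Fin n) K) :
        symplecticGroup (Fin n) K ⧸ symplecticInt (Fin n) K).out, ?_, by rw [mul_inv_cancel_left]⟩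
    rw [← QuotientGroup.eq, QuotientGroup.out_eq']
  rw [h, symplecticIwasawaExp_mul_of_mem_symplecticInt hϖ _ hk]

/-- **Equality case of (4.4.4) (i)**: if `gK₀ ⊆ K₀ d(a) K₀` (`a` antitone) and the head sums of `a` are conversely bounded
by those of `a(g)`, then `a(g) = a`. [cite: BruhatTits1972, Prop. (4.4.4) (i)] -/
theorem symplecticIwasawaExp_eq_of_mem_orbit_of_forall_le (hϖ : Valued.v ϖ = WithZero.exp (-1 : ℤ)) {a : Fin n → ℕ}
    (ha : Antitone a) {g : symplecticGroup (Fin n) K}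
    (hg : (g : symplecticGroup (Fin n) K ⧸ symplecticInt (Fin n) K) ∈ MulAction.orbit (symplecticInt (Fin n) K)
      ((⟨Matrix.diagonal (Sum.elim (fun i => ϖ ^ a i) (fun i => (ϖ ^ a i)⁻¹)),
          diagonal_pow_mem_symplecticGroup (CartanUnique.uniformizer_ne_zero hϖ) a⟩ : symplecticGroup (Fin n) K) :
        symplecticGroup (Fin n) K ⧸ symplecticInt (Fin n) K))
    (hle : ∀ r : ℕ, ((∑ i : Fin n, if (i : ℕ) < r then a i else 0 : ℕ) : ℤ) ≤
      ∑ i : Fin n, if (i : ℕ) < r then symplecticIwasawaExp hϖ g i else 0) :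
    symplecticIwasawaExp hϖ g = fun i => (a i : ℤ) := by
  refine eq_of_forall_sum_ite_lt_eq fun r => le_antisymm ?_ ?_
  · have h := sum_symplecticIwasawaExp_head_le hϖ ha hg r
    rwa [Nat.cast_sum, Finset.sum_congr rfl fun i _ => (apply_ite (fun x : ℕ => (x : ℤ)) _ _ _)] at h
  · have h := hle r
    rwa [Nat.cast_sum, Finset.sum_congr rfl fun i _ => (apply_ite (fun x : ℕ => (x : ℤ)) _ _ _)] at h

/-- **Every coset lies in some `K₀ d(a) K₀` with `a` antitone** (the Cartan decomposition of `Sp`, recast on `G/K₀`).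
[cite: BruhatTits1972, §4.4 (4.4.3)] [cite: AndrianovZhuravlev1995, Ch. 3 §3 Lemma 3.6] -/
theorem exists_antitone_mem_orbit (hϖ : Valued.v ϖ = WithZero.exp (-1 : ℤ))
    (γ₀ : symplecticGroup (Fin n) K ⧸ symplecticInt (Fin n) K) :
    ∃ a : Fin n → ℕ, Antitone a ∧
      ((⟨Matrix.diagonal (Sum.elim (fun i => ϖ ^ a i) (fun i => (ϖ ^ a i)⁻¹)),
          diagonal_pow_mem_symplecticGroup (CartanUnique.uniformizer_ne_zero hϖ) a⟩ : symplecticGroup (Fin n) K) :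
        symplecticGroup (Fin n) K ⧸ symplecticInt (Fin n) K) ∈ MulAction.orbit (symplecticInt (Fin n) K) γ₀ := by
  obtain ⟨k₁, k₂, a, hk₁, hk₂, ha, h⟩ := exists_cartan_decomposition_antitone hϖ γ₀.out
  refine ⟨a, ha, ?_⟩
  have hd : ((⟨Matrix.diagonal (Sum.elim (fun i => ϖ ^ a i) (fun i => (ϖ ^ a i)⁻¹)),
      diagonal_pow_mem_symplecticGroup (CartanUnique.uniformizer_ne_zero hϖ) a⟩ : symplecticGroup (Fin n) K)) =
        k₁ * γ₀.out * k₂ := Subtype.ext h.symm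
  rw [← QuotientGroup.out_eq' γ₀, heckeAlgebra.coe_mem_orbit_coe_iff]
  exact ⟨k₁, hk₁, k₂, hk₂, hd⟩

end Literature.NumberTheory.Automorphic.SymplecticCartan

end
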